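import Literature.Barriers.CriticalPhenomena.SAPAnisotropicNotDFinite242Recurrence
import Literature.Barriers.CriticalPhenomena.SAPRowRational
import Literature.Probability.RandomPlanarGeometry.SAWCount
import HarnessLib

/-!
# `f_1(s;x) = sx/(1-sx)`: the 2-4-2 polygons with two vertical bonds are the unit-height
# rectangles — discharge of `Rechnitzer2006_lem25_one`

Proofs companion of `Literature/Barriers/CriticalPhenomena/SAPAnisotropicNotDFinite242Recurrence.lean`
(A. Rechnitzer, *Haruspicy 2: The anisotropic generating function of self-avoiding polygons is
not D-finite*, J. Combin. Theory Ser. A 113 (2006) 520–546; arXiv:math/0406450v2), whose named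
fact `Rechnitzer2006_lem25_one` is the first line of the recurrence of **Lemma 25**,
"`f_1(s;x) = sx/(1-sx)`", over the two-variable generating function `sap242BGF 1` of the 2-4-2
polygons with `2` vertical bonds (built on the rooted-walk counts `p242Count 1 m w` of
`SAPAnisotropicNotDFinite242`): "if `n = 1` all configurations are rectangles" (§1). This file
PROVES it (`Rechnitzer2006_lem25_one_holds`), so that the trust base of `Rechnitzer2006_thm16`
(through `Rechnitzer2006_thm16_of_cor13_lem20_lem25`) and of the companion's
`sapAnisotropicNotDFinite_of_thm1_242` (through `Rechnitzer2006_eq38_of_lem25`,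
`Rechnitzer2006_lem25_f1_of_one`) loses this leaf.

## Contents

* Rooted polygons through vertex functions: `map_toProd_darts` (the darts of a Mathlib walk via
  `getVert`), `closedVerts` (the closed-up vertex function `c(0), …, c(N-1), c(N) = 0` of a
  rooted polygon `(e, ω)`, `N = |ω| + 1`), `polygonBonds_eq_closedVerts`, `countP_polygonBonds`
  (every `countP` statistic of `polygonBonds` is a count over the `N` steps of `c`),
  `yMin_polygonBonds` / `yMax_polygonBonds` (`yMin`, `yMax` are the extreme ordinates of `c`).
* `IsClosedLoop N c` (`c(0) = c(N) = 0`, nearest-neighbour steps, `c(0), …, c(N-1)` distinct) and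
  the **classification** `IsClosedLoop.classify`: a closed self-avoiding loop of `2M+2` steps,
  `M ≥ 1`, with `2M` horizontal steps is `rectFun M t₁ D v` — `t₁ ≤ M` steps along the axis in
  the direction `D = ±1`, up (or down, `v = ±1`), `M` steps back, down, and home — proved by the
  run structure of the horizontal steps (no immediate reversal, `IsClosedLoop.dx_succ`; constant
  speed along a run, `IsClosedLoop.run`; the wrap-around at the root) and the balance of the
  abscissa (`balance_solve`).
* The rectangle walks `rectFun`, `rectWalk` and their statistics (`card_filter_rectFun_hor`,
  `filter_rectFun_rowVertical`, `card_filter_rectFun_bottom`, `stats_of_closedVerts_eq_rectFun`: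
  `2M` horizontal bonds, one cell row carrying the two vertical bonds, bottom row of width `M`).
* The count: `rooted242Count_one` (`rooted242Count 1 M w = 4(M+1) [w = M]` for `M ≥ 1`: the
  rooted versions are parametrised injectively by `(t₁, D, v) ∈ {0,…,M} × {±1}²`, `rectParam`,
  and the classification shows these are all — Madras–Slade's `2N` rooted walks per polygon, here
  `N = 2M+2`), `p242Count_one` (`p^{242}_1(M, w) = [w = M ≥ 1]`), `coeff_sap242BGF_one`
  (`[x^M] f_1 = s^M` for `M ≥ 1`) and `Rechnitzer2006_lem25_one_holds`.
* Consequences (section `Consequences`): the companion's leaf `Rechnitzer2006_lem25_f1` is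
  DISCHARGED (`Rechnitzer2006_lem25_f1_holds`); `Rechnitzer2006_eq38_of_lem25_rec :
  lem25_rec → Rechnitzer2006_eq38`; with `Rechnitzer2006_thm1_holds` (`SAPRowRational`, the
  column-level haruspicy) the barrier follows from the two remaining leaves,
  `sapAnisotropicNotDFinite_of_lem20_lem25_rec : Rechnitzer2006_lem20 → Rechnitzer2006_lem25_rec
  → SAPAnisotropicNotDFinite`, and Theorem 16 from three,
  `Rechnitzer2006_thm16_of_cor13_lem20_lem25_rec`.

## References

* A. Rechnitzer, *Haruspicy 2*, op. cit.: §1 ("if `n = 1` all configurations are rectangles"),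
  Lemma 23 (bottom row), Lemma 25. [Rechnitzer2006Haruspicy2]
* N. Madras, G. Slade, *The Self-Avoiding Walk*, Birkhäuser 1993: Definition 3.2.1 and
  eq. (3.2.1) (rooted walks vs polygons, `2N`-to-one). [MadrasSlade1993]
-/

noncomputable section

open Finset Literature.Probability.LatticeModels
open scoped BigOperators Polynomial

namespace Literature.Barriers.CriticalPhenomena

/-! ### Darts of a walk through `getVert`; statistics of `polygonBonds` -/

section WalkVerts

variable {V : Type*} {G : SimpleGraph V}

/-- The darts of a walk, as pairs, listed through `getVert`. [folklore] -/
theorem map_toProd_darts {u v : V} (p : G.Walk u v) :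
    p.darts.map SimpleGraph.Dart.toProd =
      (List.range p.length).map fun i => (p.getVert i, p.getVert (i + 1)) := by
  induction p with
  | nil => simp
  | @cons a b c h q ih =>
    rw [SimpleGraph.Walk.darts_cons, List.map_cons, ih, SimpleGraph.Walk.length_cons,
      List.range_succ_eq_map, List.map_cons, List.map_map]
    simp [SimpleGraph.Walk.getVert_cons_succ, Function.comp_def]

/-- `countP` over `List.range`. [folklore] -/
theorem countP_map_range (n : ℕ) {α : Type*} (g : ℕ → α) (P : α → Bool) :
    ((List.range n).map g).countP P = ((Finset.range n).filter fun i => P (g i)).card := by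
  induction n with
  | zero => simp
  | succ n ih =>
    rw [List.range_succ, List.map_append, List.countP_append, ih, List.map_singleton,
      Finset.range_add_one, Finset.filter_insert]
    by_cases h : P (g n)
    · rw [if_pos h, Finset.card_insert_of_notMem (by simp), List.countP_cons_of_pos h]
      simp
    · rw [if_neg h, List.countP_cons_of_neg h]
      simp

end WalkVerts

section ClosedVerts

/-- The closed-up vertex function of a rooted polygon `(e, ω)`: `ω(i)` for `i ≤ |ω|`, then the
root `0` at time `|ω| + 1`. [cite: MadrasSlade1993, Definition 3.2.1] -/
def closedVerts {e : Site 2} (p : (zdGraph 2).Walk (0 : Site 2) e) (i : ℕ) : Site 2 :=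
  if i ≤ p.length then p.getVert i else 0

variable {e : Site 2} (p : (zdGraph 2).Walk (0 : Site 2) e)

/-- Before closing up, `closedVerts` is `getVert`. [folklore] -/
theorem closedVerts_of_le {i : ℕ} (hi : i ≤ p.length) : closedVerts p i = p.getVert i := if_pos hi

/-- The last vertex of the walk. [folklore] -/
theorem closedVerts_length : closedVerts p p.length = e := by
  rw [closedVerts_of_le p le_rfl, SimpleGraph.Walk.getVert_length]

/-- After the closing bond the polygon is back at the root. [folklore] -/
theorem closedVerts_length_succ : closedVerts p (p.length + 1) = 0 := if_neg (by omega)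

/-- The root. [folklore] -/
theorem closedVerts_zero : closedVerts p 0 = 0 := by
  rw [closedVerts_of_le p (Nat.zero_le _), SimpleGraph.Walk.getVert_zero]

/-- `polygonBonds` through the closed-up vertex function. [cite: MadrasSlade1993, Definition 3.2.1] -/
theorem polygonBonds_eq_closedVerts :
    polygonBonds p = (closedVerts p p.length, closedVerts p (p.length + 1)) ::
      (List.range p.length).map fun i => (closedVerts p i, closedVerts p (i + 1)) := by
  rw [polygonBonds, closedVerts_length, closedVerts_length_succ, map_toProd_darts]
  congr 1
  refine List.map_congr_left fun i hi => ?_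
  rw [List.mem_range] at hi
  rw [closedVerts_of_le p hi.le, closedVerts_of_le p hi]

/-- Counting statistics of `polygonBonds` through the closed-up vertex function.
[cite: MadrasSlade1993, Definition 3.2.1] -/
theorem countP_polygonBonds (P : Site 2 × Site 2 → Bool) :
    (polygonBonds p).countP P =
      ((Finset.range (p.length + 1)).filter fun i => P (closedVerts p i, closedVerts p (i + 1))).card := by
  rw [polygonBonds_eq_closedVerts, List.countP_cons, countP_map_range, Finset.range_add_one,
    Finset.filter_insert]
  by_cases h : P (closedVerts p p.length, closedVerts p (p.length + 1))
  · rw [if_pos h, if_pos h, Finset.card_insert_of_notMem (by simp)]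
  · rw [if_neg h, if_neg h, Nat.add_zero]

/-- Lower bound property of `foldr min`. [folklore] -/
theorem foldr_min_le_init (a : ℤ) (l : List ℤ) : l.foldr min a ≤ a := by
  induction l with
  | nil => simp
  | cons x l ih => exact (min_le_right _ _).trans ih

/-- Lower bound property of `foldr min`. [folklore] -/
theorem foldr_min_le_of_mem {a x : ℤ} {l : List ℤ} (hx : x ∈ l) : l.foldr min a ≤ x := by
  induction l with
  | nil => simp at hx
  | cons y l ih =>
    rw [List.foldr_cons]
    rcases List.mem_cons.mp hx with rfl | hx
    · exact min_le_left _ _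
    · exact (min_le_right _ _).trans (ih hx)

/-- `foldr min` is attained. [folklore] -/
theorem foldr_min_mem (a : ℤ) (l : List ℤ) : l.foldr min a = a ∨ l.foldr min a ∈ l := by
  induction l with
  | nil => simp
  | cons y l ih =>
    rw [List.foldr_cons]
    rcases min_choice y (l.foldr min a) with h | h <;> rw [h]
    · exact Or.inr (List.mem_cons_self)
    · rcases ih with h' | h'
      · exact Or.inl h'
      · exact Or.inr (List.mem_cons_of_mem _ h')

/-- Upper bound property of `foldr max`. [folklore] -/
theorem le_foldr_max_init (a : ℤ) (l : List ℤ) : a ≤ l.foldr max a := by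
  induction l with
  | nil => simp
  | cons x l ih => exact ih.trans (le_max_right _ _)

/-- Upper bound property of `foldr max`. [folklore] -/
theorem le_foldr_max_of_mem {a x : ℤ} {l : List ℤ} (hx : x ∈ l) : x ≤ l.foldr max a := by
  induction l with
  | nil => simp at hx
  | cons y l ih =>
    rw [List.foldr_cons]
    rcases List.mem_cons.mp hx with rfl | hx
    · exact le_max_left _ _
    · exact (ih hx).trans (le_max_right _ _)

/-- `foldr max` is attained. [folklore] -/
theorem foldr_max_mem (a : ℤ) (l : List ℤ) : l.foldr max a = a ∨ l.foldr max a ∈ l := by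
  induction l with
  | nil => simp
  | cons y l ih =>
    rw [List.foldr_cons]
    rcases max_choice y (l.foldr max a) with h | h <;> rw [h]
    · exact Or.inr (List.mem_cons_self)
    · rcases ih with h' | h'
      · exact Or.inl h'
      · exact Or.inr (List.mem_cons_of_mem _ h')

/-- `yMin` of a rooted polygon is the least ordinate of its vertices `c(0), …, c(|ω|)`.
[cite: Rechnitzer2006Haruspicy2, Definition 18] -/
theorem yMin_polygonBonds :
    (∀ i ≤ p.length, yMin (polygonBonds p) ≤ closedVerts p i 1) ∧
      ∃ i ≤ p.length, yMin (polygonBonds p) = closedVerts p i 1 := by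
  have hL : (polygonBonds p).map (fun b => b.1 1) =
      closedVerts p p.length 1 :: (List.range p.length).map fun i => closedVerts p i 1 := by
    rw [polygonBonds_eq_closedVerts, List.map_cons, List.map_map]; rfl
  rw [yMin, hL]
  refine ⟨fun i hi => ?_, ?_⟩
  · rcases hi.lt_or_eq with hi | rfl
    · exact foldr_min_le_of_mem (List.mem_cons_of_mem _ (List.mem_map.mpr ⟨i, List.mem_range.mpr hi, rfl⟩))
    · exact foldr_min_le_of_mem List.mem_cons_self
  · rcases foldr_min_mem 0 (closedVerts p p.length 1 :: (List.range p.length).map fun i => closedVerts p i 1)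
      with h | h
    · exact ⟨0, Nat.zero_le _, by rw [h, closedVerts_zero]; rfl⟩
    · rcases List.mem_cons.mp h with h | h
      · exact ⟨p.length, le_rfl, h⟩
      · obtain ⟨i, hi, hi'⟩ := List.mem_map.mp h
        exact ⟨i, (List.mem_range.mp hi).le, hi'.symm⟩

/-- `yMax` of a rooted polygon is the largest ordinate of its vertices.
[cite: Rechnitzer2006Haruspicy2, Definition 18] -/
theorem yMax_polygonBonds :
    (∀ i ≤ p.length, closedVerts p i 1 ≤ yMax (polygonBonds p)) ∧
      ∃ i ≤ p.length, yMax (polygonBonds p) = closedVerts p i 1 := by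
  have hL : (polygonBonds p).map (fun b => b.1 1) =
      closedVerts p p.length 1 :: (List.range p.length).map fun i => closedVerts p i 1 := by
    rw [polygonBonds_eq_closedVerts, List.map_cons, List.map_map]; rfl
  rw [yMax, hL]
  refine ⟨fun i hi => ?_, ?_⟩
  · rcases hi.lt_or_eq with hi | rfl
    · exact le_foldr_max_of_mem (List.mem_cons_of_mem _ (List.mem_map.mpr ⟨i, List.mem_range.mpr hi, rfl⟩))
    · exact le_foldr_max_of_mem List.mem_cons_self
  · rcases foldr_max_mem 0 (closedVerts p p.length 1 :: (List.range p.length).map fun i => closedVerts p i 1)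
      with h | h
    · exact ⟨0, Nat.zero_le _, by rw [h, closedVerts_zero]; rfl⟩
    · rcases List.mem_cons.mp h with h | h
      · exact ⟨p.length, le_rfl, h⟩
      · obtain ⟨i, hi, hi'⟩ := List.mem_map.mp h
        exact ⟨i, (List.mem_range.mp hi).le, hi'.symm⟩

end ClosedVerts

/-! ### Closed self-avoiding loops on `ℤ²` with two vertical steps are unit-height rectangles -/

section Classify

/-- Equality of sites of `ℤ²` through coordinates (local copy of `Site.eq_iff_two`). [folklore] -/
private theorem site_eq_iff {a b : Site 2} : a = b ↔ a 0 = b 0 ∧ a 1 = b 1 := by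
  constructor
  · rintro rfl; exact ⟨rfl, rfl⟩
  · rintro ⟨h0, h1⟩
    funext j
    fin_cases j
    · exact h0
    · exact h1

/-- A closed self-avoiding loop of `N` steps on `ℤ²` through the origin, as a vertex function:
`c(0) = c(N) = 0`, nearest-neighbour steps, and `c(0), …, c(N-1)` pairwise distinct (the
closed-up vertex function of a rooted polygon). [cite: MadrasSlade1993, Definition 3.2.1] -/
structure IsClosedLoop (N : ℕ) (c : ℕ → Site 2) : Prop where
  zero : c 0 = 0
  closed : c N = 0
  adj : ∀ i < N, (zdGraph 2).Adj (c i) (c (i + 1))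
  injOn : Set.InjOn c {i | i < N}

namespace IsClosedLoop

variable {N : ℕ} {c : ℕ → Site 2} (h : IsClosedLoop N c)
include h

/-- The four kinds of steps. [folklore] -/
theorem step_cases {i : ℕ} (hi : i < N) :
    (c (i + 1) 0 = c i 0 + 1 ∧ c (i + 1) 1 = c i 1) ∨ (c i 0 = c (i + 1) 0 + 1 ∧ c i 1 = c (i + 1) 1) ∨
      (c (i + 1) 0 = c i 0 ∧ c (i + 1) 1 = c i 1 + 1) ∨ (c i 0 = c (i + 1) 0 ∧ c i 1 = c (i + 1) 1 + 1) :=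
  adj_cases (h.adj i hi)

/-- No return after two steps (for `N ≥ 4`). [folklore] -/
theorem ne_two (hN : 4 ≤ N) {i : ℕ} (hi : i + 2 ≤ N) :
    ¬ (c (i + 2) 0 = c i 0 ∧ c (i + 2) 1 = c i 1) := by
  intro hc
  have heq : c (i + 2) = c i := site_eq_iff.mpr hc
  rcases hi.lt_or_eq with hi | hi
  · have := h.injOn (show i + 2 ∈ {i | i < N} from hi) (show i ∈ {i | i < N} by simp; omega) heq
    omega
  · have h0 : c i = c 0 := by rw [← heq, hi, h.closed, h.zero]
    have := h.injOn (show i ∈ {i | i < N} by simp; omega) (show 0 ∈ {i | i < N} by simp; omega) h0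
    omega

/-- Two consecutive horizontal steps go the same way. [folklore] -/
theorem dx_succ (hN : 4 ≤ N) {i : ℕ} (hi : i + 2 ≤ N) (h1 : c i 1 = c (i + 1) 1)
    (h2 : c (i + 1) 1 = c (i + 2) 1) :
    c (i + 2) 0 - c (i + 1) 0 = c (i + 1) 0 - c i 0 := by
  have hne := h.ne_two hN hi
  have hs := h.step_cases (show i + 1 < N by omega)
  rw [show i + 1 + 1 = i + 2 from rfl] at hs
  rcases h.step_cases (show i < N by omega) with ⟨a0, -⟩ | ⟨a0, -⟩ | ⟨-, a1⟩ | ⟨-, a1⟩ <;>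
    rcases hs with ⟨b0, -⟩ | ⟨b0, -⟩ | ⟨-, b1⟩ | ⟨-, b1⟩ <;> omega

/-- Along a run of horizontal steps `[a, b)`, the ordinate is constant and the abscissa moves at
the constant unit speed of the first step. [folklore] -/
theorem run (hN : 4 ≤ N) {a b : ℕ} (hb : b ≤ N)
    (hrun : ∀ j, a ≤ j → j < b → c j 1 = c (j + 1) 1) :
    ∀ j, a ≤ j → j ≤ b →
      c j 1 = c a 1 ∧ c j 0 = c a 0 + ((j - a : ℕ) : ℤ) * (c (a + 1) 0 - c a 0) ∧
        (j < b → c (j + 1) 0 - c j 0 = c (a + 1) 0 - c a 0) := by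
  intro j haj
  induction j, haj using Nat.le_induction with
  | base => intro _; simp
  | succ j haj ih =>
    intro hjb
    obtain ⟨ih1, ih2, ih3⟩ := ih (by omega)
    have hd := ih3 (by omega)
    refine ⟨by rw [← hrun j haj (by omega), ih1], ?_, fun hjb' => ?_⟩
    · rw [show ((j + 1 - a : ℕ) : ℤ) = ((j - a : ℕ) : ℤ) + 1 by push_cast [Nat.sub_add_comm haj]; ring]
      linear_combination ih2 + hd
    · rw [← hd]
      exact h.dx_succ hN (by omega) (hrun j haj (by omega)) (hrun (j + 1) (by omega) hjb')

/-- A vertical step keeps the abscissa and changes the ordinate by `±1`. [folklore] -/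
theorem vert_step {i : ℕ} (hi : i < N) (hv : c i 1 ≠ c (i + 1) 1) :
    c (i + 1) 0 = c i 0 ∧ (c (i + 1) 1 = c i 1 + 1 ∨ c (i + 1) 1 = c i 1 - 1) := by
  rcases h.step_cases hi with ⟨-, a1⟩ | ⟨-, a1⟩ | ⟨a0, a1⟩ | ⟨a0, a1⟩
  · exact absurd a1.symm hv
  · exact absurd a1 hv
  · exact ⟨a0, Or.inl a1⟩
  · exact ⟨a0.symm, Or.inr (by omega)⟩

/-- A horizontal step changes the abscissa by `±1`. [folklore] -/
theorem hor_step {i : ℕ} (hi : i < N) (hh : c i 1 = c (i + 1) 1) :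
    c (i + 1) 0 - c i 0 = 1 ∨ c (i + 1) 0 - c i 0 = -1 := by
  rcases h.step_cases hi with ⟨a0, -⟩ | ⟨a0, -⟩ | ⟨-, a1⟩ | ⟨-, a1⟩
  · left; omega
  · right; omega
  · omega
  · omega

end IsClosedLoop

/-- The vertex function of the rooted walk around a unit-height rectangle of length `M`: `t₁`
steps in the direction `D = ±1` along the axis, one vertical step to height `v = ±1`, `M` steps
back, one vertical step to the axis, and `M - t₁` steps to the origin.
[cite: Rechnitzer2006Haruspicy2, Lemma 25] -/
def rectFun (M t₁ : ℕ) (D v : ℤ) (i : ℕ) : Site 2 :=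
  if i ≤ t₁ then ![D * i, 0]
  else if i ≤ t₁ + M + 1 then ![D * (2 * t₁ + 1 - i : ℤ), v]
  else ![D * ((i : ℤ) - (2 * M + 2 : ℕ)), 0]

/-- Solving the balance equations of the classification. [folklore] -/
theorem balance_solve {M t₁ B R : ℕ} {d₀ d₁ d₂ : ℤ} (hM : 1 ≤ M) (hB : 1 ≤ B)
    (hsum : t₁ + B + R = 2 * M) (hbal : (t₁ : ℤ) * d₀ + B * d₁ + R * d₂ = 0)
    (hd₁ : d₁ = 1 ∨ d₁ = -1) (hd₀ : 1 ≤ t₁ → d₀ = 1 ∨ d₀ = -1) (hd₂ : 1 ≤ R → d₂ = 1 ∨ d₂ = -1)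
    (hwrap : 1 ≤ t₁ → 1 ≤ R → d₀ = d₂) :
    B = M ∧ t₁ + R = M ∧ (1 ≤ t₁ → d₀ = -d₁) ∧ (1 ≤ R → d₂ = -d₁) := by
  rcases Nat.lt_or_ge t₁ 1 with ht | ht <;> rcases Nat.lt_or_ge R 1 with hR | hR
  · obtain rfl : t₁ = 0 := by omega
    obtain rfl : R = 0 := by omega
    simp only [Nat.cast_zero, zero_mul, zero_add, add_zero] at hbal
    rcases hd₁ with rfl | rfl <;> omega
  · obtain rfl : t₁ = 0 := by omega
    simp only [Nat.cast_zero, zero_mul, zero_add] at hbal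
    rcases hd₁ with rfl | rfl <;> rcases hd₂ hR with rfl | rfl <;> refine ⟨?_, ?_, ?_, ?_⟩ <;> omega
  · obtain rfl : R = 0 := by omega
    simp only [Nat.cast_zero, zero_mul, add_zero] at hbal
    rcases hd₁ with rfl | rfl <;> rcases hd₀ ht with rfl | rfl <;> refine ⟨?_, ?_, ?_, ?_⟩ <;> omega
  · have hw := hwrap ht hR
    subst hw
    rcases hd₁ with rfl | rfl <;> rcases hd₀ ht with rfl | rfl <;> refine ⟨?_, ?_, ?_, ?_⟩ <;> omega

/-- Coordinates of `![x, y]` (local copy of `site_mk_apply_zero`). [folklore] -/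
@[simp] private theorem vec2_zero (x y : ℤ) : (![x, y] : Site 2) 0 = x := rfl

/-- Coordinates of `![x, y]` (local copy of `site_mk_apply_one`). [folklore] -/
@[simp] private theorem vec2_one (x y : ℤ) : (![x, y] : Site 2) 1 = y := rfl

/-- **Classification.** A closed self-avoiding loop of `2M+2` steps (`M ≥ 1`) with exactly `2M`
horizontal steps is the walk around a unit-height rectangle of length `M`: it is `rectFun M t₁ D v`
for some `t₁ ≤ M` and signs `D`, `v`. [cite: Rechnitzer2006Haruspicy2, §1 ("if `n = 1` all configurations are rectangles")] -/
theorem IsClosedLoop.classify {M : ℕ} (hM : 1 ≤ M) {c : ℕ → Site 2}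
    (h : IsClosedLoop (2 * M + 2) c)
    (hhor : ((Finset.range (2 * M + 2)).filter fun i => c i 1 = c (i + 1) 1).card = 2 * M) :
    ∃ t₁ ≤ M, ∃ D v : ℤ, (D = 1 ∨ D = -1) ∧ (v = 1 ∨ v = -1) ∧
      ∀ i ≤ 2 * M + 2, c i = rectFun M t₁ D v i := by
  have hN4 : 4 ≤ 2 * M + 2 := by omega
  -- the two vertical steps `t₁ < t₂`
  have hTcard : ((Finset.range (2 * M + 2)).filter fun i => ¬ c i 1 = c (i + 1) 1).card = 2 := by
    have := Finset.card_filter_add_card_filter_not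
      (s := Finset.range (2 * M + 2)) (p := fun i => c i 1 = c (i + 1) 1)
    rw [hhor, Finset.card_range] at this
    omega
  obtain ⟨t₁, t₂, hne, hT12⟩ := Finset.card_eq_two.mp hTcard
  wlog hlt : t₁ < t₂ generalizing t₁ t₂
  · exact this t₂ t₁ hne.symm (by rw [hT12, Finset.pair_comm]) (by omega)
  have ht₁T : t₁ < 2 * M + 2 ∧ ¬ c t₁ 1 = c (t₁ + 1) 1 := by
    have : t₁ ∈ ({t₁, t₂} : Finset ℕ) := by simp
    rw [← hT12, Finset.mem_filter, Finset.mem_range] at this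
    exact this
  have ht₂T : t₂ < 2 * M + 2 ∧ ¬ c t₂ 1 = c (t₂ + 1) 1 := by
    have : t₂ ∈ ({t₁, t₂} : Finset ℕ) := by simp
    rw [← hT12, Finset.mem_filter, Finset.mem_range] at this
    exact this
  have hor_of : ∀ i < 2 * M + 2, i ≠ t₁ → i ≠ t₂ → c i 1 = c (i + 1) 1 := by
    intro i hi h1 h2
    by_contra hc
    have : i ∈ (Finset.range (2 * M + 2)).filter fun i => ¬ c i 1 = c (i + 1) 1 := by
      rw [Finset.mem_filter, Finset.mem_range]; exact ⟨hi, hc⟩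
    rw [hT12, Finset.mem_insert, Finset.mem_singleton] at this
    omega
  have h0y : c 0 1 = 0 := by rw [h.zero]; rfl
  have h0x : c 0 0 = 0 := by rw [h.zero]; rfl
  have hNy : c (2 * M + 2) 1 = 0 := by rw [h.closed]; rfl
  have hNx : c (2 * M + 2) 0 = 0 := by rw [h.closed]; rfl
  -- run 1, vertical step 1, run 2, vertical step 2, run 3
  have run1 := h.run hN4 (show t₁ ≤ 2 * M + 2 by omega) (a := 0)
    (fun j hj hjt => hor_of j (by omega) (by omega) (by omega))
  obtain ⟨hx₁, hv⟩ := h.vert_step ht₁T.1 ht₁T.2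
  have run2 := h.run hN4 (show t₂ ≤ 2 * M + 2 by omega) (a := t₁ + 1)
    (fun j hj hjt => hor_of j (by omega) (by omega) (by omega))
  obtain ⟨hx₂, hv'⟩ := h.vert_step ht₂T.1 ht₂T.2
  have run3 := h.run hN4 (le_refl (2 * M + 2)) (a := t₂ + 1)
    (fun j hj hjt => hor_of j (by omega) (by omega) (by omega))
  -- heights
  have hyt₁ : c t₁ 1 = 0 := by rw [(run1 t₁ (Nat.zero_le _) le_rfl).1, h0y]
  have hyt₂ : c t₂ 1 = c (t₁ + 1) 1 := (run2 t₂ (by omega) le_rfl).1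
  have hy3 : c (t₂ + 1) 1 = 0 := by rw [← hNy]; exact ((run3 (2 * M + 2) (by omega) le_rfl).1).symm
  -- the middle run is not empty
  have hmid : t₁ + 1 < t₂ := by
    by_contra hc
    have ht : t₂ = t₁ + 1 := by omega
    subst ht
    apply h.ne_two hN4 (i := t₁) (by omega)
    rw [show t₁ + 2 = t₁ + 1 + 1 from rfl]
    constructor
    · rw [hx₂, hx₁]
    · rw [hy3, hyt₁]
  -- directions of the three runs
  have hd₁ := h.hor_step (i := t₁ + 1) (by omega) (hor_of _ (by omega) (by omega) (by omega))
  have hd₀ : 1 ≤ t₁ → c (0 + 1) 0 - c 0 0 = 1 ∨ c (0 + 1) 0 - c 0 0 = -1 := fun ht =>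
    h.hor_step (i := 0) (by omega) (hor_of _ (by omega) (by omega) (by omega))
  have hd₂ : 1 ≤ 2 * M + 2 - 1 - t₂ →
      c (t₂ + 1 + 1) 0 - c (t₂ + 1) 0 = 1 ∨ c (t₂ + 1 + 1) 0 - c (t₂ + 1) 0 = -1 := fun hR =>
    h.hor_step (i := t₂ + 1) (by omega) (hor_of _ (by omega) (by omega) (by omega))
  -- positions at the ends of the runs
  have hpt₁ := (run1 t₁ (Nat.zero_le _) le_rfl).2.1
  have hpt₂ := (run2 t₂ (by omega) le_rfl).2.1
  have hpN := (run3 (2 * M + 2) (by omega) le_rfl).2.1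
  -- wrap-around: the first and the last step go the same way
  have hwrap : 1 ≤ t₁ → 1 ≤ 2 * M + 2 - 1 - t₂ →
      c (0 + 1) 0 - c 0 0 = c (t₂ + 1 + 1) 0 - c (t₂ + 1) 0 := by
    intro ht hR
    have hpN1 := run3 (2 * M + 2 - 1) (by omega) (by omega)
    have hlast := hpN1.2.2 (by omega)
    rw [show 2 * M + 2 - 1 + 1 = 2 * M + 2 by omega] at hlast
    have hy1 : c (0 + 1) 1 = 0 := by rw [(run1 (0 + 1) (by omega) (by omega)).1, h0y]
    by_contra hne'
    have heq : c (0 + 1) = c (2 * M + 2 - 1) := by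
      rw [site_eq_iff]
      refine ⟨?_, by rw [hy1, hpN1.1, hy3]⟩
      rcases hd₀ ht with e0 | e0 <;> rcases hd₂ hR with e2 | e2 <;> omega
    have := h.injOn (show 0 + 1 ∈ {i | i < 2 * M + 2} by simp only [Set.mem_setOf_eq]; omega)
      (show 2 * M + 2 - 1 ∈ {i | i < 2 * M + 2} by simp only [Set.mem_setOf_eq]; omega) heq
    omega
  -- solve the balance equations
  have hbal : (t₁ : ℤ) * (c (0 + 1) 0 - c 0 0) +
      ((t₂ - t₁ - 1 : ℕ) : ℤ) * (c (t₁ + 1 + 1) 0 - c (t₁ + 1) 0) +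
        ((2 * M + 2 - 1 - t₂ : ℕ) : ℤ) * (c (t₂ + 1 + 1) 0 - c (t₂ + 1) 0) = 0 := by
    have e1 : ((t₂ - (t₁ + 1) : ℕ) : ℤ) = ((t₂ - t₁ - 1 : ℕ) : ℤ) := by congr 1
    have e2 : ((2 * M + 2 - (t₂ + 1) : ℕ) : ℤ) = ((2 * M + 2 - 1 - t₂ : ℕ) : ℤ) := by congr 1; omega
    have hpt₂' := hpt₂
    have hpN' := hpN
    have hpt₁' := hpt₁
    rw [e1] at hpt₂'
    rw [e2] at hpN'
    push_cast [Nat.sub_zero] at hpt₁'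
    linear_combination -hpN' - hpt₂' - hpt₁' + hNx - hx₂ - hx₁ - h0x
  obtain ⟨hB, hsum, hD₀, hD₂⟩ := balance_solve hM (show 1 ≤ t₂ - t₁ - 1 by omega) (by omega) hbal
    hd₁ hd₀ hd₂ hwrap
  set D : ℤ := -(c (t₁ + 1 + 1) 0 - c (t₁ + 1) 0) with hDdef
  set v : ℤ := c (t₁ + 1) 1 with hvdef
  have hD : D = 1 ∨ D = -1 := by rcases hd₁ with e | e <;> [right; left] <;> omega
  have hv1 : v = 1 ∨ v = -1 := by rcases hv with e | e <;> [left; right] <;> omega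
  refine ⟨t₁, by omega, D, v, hD, hv1, fun i hi => ?_⟩
  -- fix the sign of the middle run; all differences become numerals
  have key : ∀ s : ℤ, (s = 1 ∨ s = -1) → c (t₁ + 1 + 1) 0 - c (t₁ + 1) 0 = s →
      c i = rectFun M t₁ D v i := by
    intro s hs e1
    have hDval : D = -s := by rw [hDdef, e1]
    rw [rectFun, site_eq_iff]
    rcases le_or_gt i t₁ with hi₁ | hi₁
    · -- run 1
      rw [if_pos hi₁, vec2_zero, vec2_one]
      obtain ⟨r1, r2, -⟩ := run1 i (Nat.zero_le _) hi₁
      refine ⟨?_, by rw [r1, h0y]⟩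
      rcases Nat.lt_or_ge t₁ 1 with ht | ht
      · have : i = 0 := by omega
        subst this; simp [h0x]
      · rw [hD₀ ht] at r2
        rw [hDval] at r2 ⊢
        rcases hs with rfl | rfl <;> push_cast at r2 ⊢ <;> omega
    rcases le_or_gt i (t₁ + M + 1) with hi₂ | hi₂
    · -- run 2
      rw [if_neg (by omega), if_pos hi₂, vec2_zero, vec2_one]
      obtain ⟨r1, r2, -⟩ := run2 i (by omega) (by omega)
      refine ⟨?_, r1⟩
      rw [e1] at r2
      rw [hDval]
      rcases Nat.lt_or_ge t₁ 1 with ht | ht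
      · have ht0 : t₁ = 0 := by omega
        subst ht0
        rcases hs with rfl | rfl <;> push_cast at r2 hx₁ ⊢ <;> omega
      · have hp := hpt₁
        rw [hD₀ ht, hDval] at hp
        rcases hs with rfl | rfl <;> push_cast at r2 hp ⊢ <;> omega
    · -- run 3
      rw [if_neg (by omega), if_neg (by omega), vec2_zero, vec2_one]
      obtain ⟨r1, r2, -⟩ := run3 i (by omega) hi
      refine ⟨?_, by rw [r1, hy3]⟩
      rw [hDval]
      rcases Nat.lt_or_ge (2 * M + 2 - 1 - t₂) 1 with hR | hR
      · -- last run empty: `i = N`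
        have hi' : i = 2 * M + 2 := by omega
        subst hi'
        rw [hNx]
        push_cast
        ring
      · rw [hD₂ hR, hDval] at r2
        have hp2 := hpt₂
        rw [e1] at hp2
        rcases Nat.lt_or_ge t₁ 1 with ht | ht
        · have ht0 : t₁ = 0 := by omega
          subst ht0
          rcases hs with rfl | rfl <;> push_cast at r2 hp2 hx₁ ⊢ <;> omega
        · have hp := hpt₁
          rw [hD₀ ht, hDval] at hp
          rcases hs with rfl | rfl <;> push_cast at r2 hp2 hp ⊢ <;> omega
  rcases hd₁ with e1 | e1
  · exact key 1 (Or.inl rfl) e1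
  · exact key (-1) (Or.inr rfl) e1

end Classify

/-! ### The rectangle walks -/

section Rectangle

/-- Converse of `adj_cases`. [folklore] -/
theorem adj_of_coords {a b : Site 2}
    (h : (b 0 = a 0 + 1 ∧ b 1 = a 1) ∨ (a 0 = b 0 + 1 ∧ a 1 = b 1) ∨
      (b 0 = a 0 ∧ b 1 = a 1 + 1) ∨ (a 0 = b 0 ∧ a 1 = b 1 + 1)) : (zdGraph 2).Adj a b := by
  rw [zdGraph_adj_iff]
  rcases h with ⟨h0, h1⟩ | ⟨h0, h1⟩ | ⟨h0, h1⟩ | ⟨h0, h1⟩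
  · exact ⟨0, Or.inl (funext fun j => by fin_cases j <;> simp [h0, h1])⟩
  · exact ⟨0, Or.inr (funext fun j => by fin_cases j <;> simp [h0, h1])⟩
  · exact ⟨1, Or.inl (funext fun j => by fin_cases j <;> simp [h0, h1])⟩
  · exact ⟨1, Or.inr (funext fun j => by fin_cases j <;> simp [h0, h1])⟩

variable {M t₁ : ℕ} {D v : ℤ}

/-- The rectangle walk starts at the origin. [folklore] -/
theorem rectFun_zero : rectFun M t₁ D v 0 = 0 := by
  simp only [rectFun, Nat.zero_le, if_true, Nat.cast_zero, mul_zero]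
  funext j; fin_cases j <;> rfl

/-- The rectangle walk returns to the origin after `2M+2` steps. [folklore] -/
theorem rectFun_N (ht : t₁ ≤ M) : rectFun M t₁ D v (2 * M + 2) = 0 := by
  rw [rectFun, if_neg (by omega), if_neg (by omega), sub_self, mul_zero]
  funext j; fin_cases j <;> rfl

/-- The coordinates of the rectangle walk, by cases. [folklore] -/
theorem rectFun_coords (i : ℕ) :
    (i ≤ t₁ ∧ rectFun M t₁ D v i 0 = D * i ∧ rectFun M t₁ D v i 1 = 0) ∨
      (t₁ < i ∧ i ≤ t₁ + M + 1 ∧ rectFun M t₁ D v i 0 = D * (2 * t₁ + 1 - i : ℤ) ∧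
        rectFun M t₁ D v i 1 = v) ∨
      (t₁ + M + 1 < i ∧ rectFun M t₁ D v i 0 = D * ((i : ℤ) - (2 * M + 2 : ℕ)) ∧
        rectFun M t₁ D v i 1 = 0) := by
  unfold rectFun
  by_cases h1 : i ≤ t₁
  · left; rw [if_pos h1]; exact ⟨h1, rfl, rfl⟩
  by_cases h2 : i ≤ t₁ + M + 1
  · right; left; rw [if_neg h1, if_pos h2]; exact ⟨by omega, h2, rfl, rfl⟩
  · right; right; rw [if_neg h1, if_neg h2]; exact ⟨by omega, rfl, rfl⟩

/-- Consecutive vertices of the rectangle walk are adjacent. [folklore] -/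
theorem rectFun_adj (hD : D = 1 ∨ D = -1) (hv : v = 1 ∨ v = -1) (i : ℕ) :
    (zdGraph 2).Adj (rectFun M t₁ D v i) (rectFun M t₁ D v (i + 1)) := by
  apply adj_of_coords
  rcases rectFun_coords (M := M) (t₁ := t₁) (D := D) (v := v) i with
      ⟨a1, ax, ay⟩ | ⟨a1, a2, ax, ay⟩ | ⟨a1, ax, ay⟩ <;>
    rcases rectFun_coords (M := M) (t₁ := t₁) (D := D) (v := v) (i + 1) with
      ⟨b1, bx, bY⟩ | ⟨b1, b2, bx, bY⟩ | ⟨b1, bx, bY⟩ <;>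
    rcases hD with rfl | rfl <;> push_cast at ax bx ⊢ <;> omega

/-- The rectangle walk visits `2M+2` distinct sites. [folklore] -/
theorem rectFun_injOn (hD : D = 1 ∨ D = -1) (hv : v = 1 ∨ v = -1) :
    Set.InjOn (rectFun M t₁ D v) {i | i < 2 * M + 2} := by
  intro i hi j hj hij
  simp only [Set.mem_setOf_eq] at hi hj
  rw [site_eq_iff] at hij
  obtain ⟨hx, hy⟩ := hij
  rcases rectFun_coords (M := M) (t₁ := t₁) (D := D) (v := v) i with
      ⟨a1, ax, ay⟩ | ⟨a1, a2, ax, ay⟩ | ⟨a1, ax, ay⟩ <;>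
    rcases rectFun_coords (M := M) (t₁ := t₁) (D := D) (v := v) j with
      ⟨b1, bx, bY⟩ | ⟨b1, b2, bx, bY⟩ | ⟨b1, bx, bY⟩ <;>
    rcases hD with rfl | rfl <;> push_cast at ax bx ⊢ <;> omega

/-- The rectangle walk is a closed self-avoiding loop. [folklore] -/
theorem isClosedLoop_rectFun (hD : D = 1 ∨ D = -1) (hv : v = 1 ∨ v = -1) (ht : t₁ ≤ M) :
    IsClosedLoop (2 * M + 2) (rectFun M t₁ D v) :=
  ⟨rectFun_zero, rectFun_N ht, fun i _ => rectFun_adj hD hv i, rectFun_injOn hD hv⟩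

/-- The steps of the rectangle walk that change the ordinate are `t₁` and `t₁ + M + 1`.
[folklore] -/
theorem filter_rectFun_vert (hv : v = 1 ∨ v = -1) (ht : t₁ ≤ M) :
    ((Finset.range (2 * M + 2)).filter fun i =>
        ¬ rectFun M t₁ D v i 1 = rectFun M t₁ D v (i + 1) 1) = {t₁, t₁ + M + 1} := by
  ext i
  simp only [Finset.mem_filter, Finset.mem_range, Finset.mem_insert, Finset.mem_singleton]
  rcases rectFun_coords (M := M) (t₁ := t₁) (D := D) (v := v) i with
      ⟨a1, -, ay⟩ | ⟨a1, a2, -, ay⟩ | ⟨a1, -, ay⟩ <;>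
    rcases rectFun_coords (M := M) (t₁ := t₁) (D := D) (v := v) (i + 1) with
      ⟨b1, -, bY⟩ | ⟨b1, b2, -, bY⟩ | ⟨b1, -, bY⟩ <;> omega

/-- Hence the rectangle walk has `2M` horizontal steps. [folklore] -/
theorem card_filter_rectFun_hor (hv : v = 1 ∨ v = -1) (ht : t₁ ≤ M) :
    ((Finset.range (2 * M + 2)).filter fun i =>
        rectFun M t₁ D v i 1 = rectFun M t₁ D v (i + 1) 1).card = 2 * M := by
  have := Finset.card_filter_add_card_filter_not (s := Finset.range (2 * M + 2))
    (p := fun i => rectFun M t₁ D v i 1 = rectFun M t₁ D v (i + 1) 1)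
  rw [filter_rectFun_vert hv ht, Finset.card_range, Finset.card_pair (by omega)] at this
  omega

/-- The vertical steps of the rectangle walk lie in the row `min 0 v`. [folklore] -/
theorem filter_rectFun_rowVertical (hD : D = 1 ∨ D = -1) (hv : v = 1 ∨ v = -1) (ht : t₁ ≤ M) :
    ((Finset.range (2 * M + 2)).filter fun i =>
        rectFun M t₁ D v i 0 = rectFun M t₁ D v (i + 1) 0 ∧
          min (rectFun M t₁ D v i 1) (rectFun M t₁ D v (i + 1) 1) = min 0 v) = {t₁, t₁ + M + 1} := by
  ext i
  simp only [Finset.mem_filter, Finset.mem_range, Finset.mem_insert, Finset.mem_singleton]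
  rcases rectFun_coords (M := M) (t₁ := t₁) (D := D) (v := v) i with
      ⟨a1, ax, ay⟩ | ⟨a1, a2, ax, ay⟩ | ⟨a1, ax, ay⟩ <;>
    rcases rectFun_coords (M := M) (t₁ := t₁) (D := D) (v := v) (i + 1) with
      ⟨b1, bx, bY⟩ | ⟨b1, b2, bx, bY⟩ | ⟨b1, bx, bY⟩ <;>
    rcases hD with rfl | rfl <;> rcases hv with rfl | rfl <;> push_cast at ax bx ⊢ <;>
    simp only [min_def] at * <;> (try split_ifs at *) <;> omega

/-- The horizontal bonds of the rectangle walk on the line `min 0 v` (its bottom row) number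
`M`. [folklore] -/
theorem card_filter_rectFun_bottom (hv : v = 1 ∨ v = -1) (ht : t₁ ≤ M) :
    ((Finset.range (2 * M + 2)).filter fun i =>
        rectFun M t₁ D v i 1 = min 0 v ∧ rectFun M t₁ D v (i + 1) 1 = min 0 v).card = M := by
  rcases hv with rfl | rfl
  · -- rectangle above the axis: bottom bonds are the steps `i < t₁` and `i ≥ t₁ + M + 2`
    have : ((Finset.range (2 * M + 2)).filter fun i =>
        rectFun M t₁ D 1 i 1 = min 0 1 ∧ rectFun M t₁ D 1 (i + 1) 1 = min 0 1) =
        Finset.range t₁ ∪ Finset.Ico (t₁ + M + 2) (2 * M + 2) := by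
      ext i
      simp only [Finset.mem_filter, Finset.mem_range, Finset.mem_union, Finset.mem_Ico,
        min_eq_left (zero_le_one : (0 : ℤ) ≤ 1)]
      rcases rectFun_coords (M := M) (t₁ := t₁) (D := D) (v := 1) i with
          ⟨a1, -, ay⟩ | ⟨a1, a2, -, ay⟩ | ⟨a1, -, ay⟩ <;>
        rcases rectFun_coords (M := M) (t₁ := t₁) (D := D) (v := 1) (i + 1) with
          ⟨b1, -, bY⟩ | ⟨b1, b2, -, bY⟩ | ⟨b1, -, bY⟩ <;> omega
    rw [this, Finset.card_union_of_disjoint, Finset.card_range, Nat.card_Ico]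
    · omega
    · rw [Finset.disjoint_left]
      intro i hi hi'
      rw [Finset.mem_range] at hi
      rw [Finset.mem_Ico] at hi'
      omega
  · -- rectangle below the axis: bottom bonds are the steps `t₁ < i ≤ t₁ + M`
    have : ((Finset.range (2 * M + 2)).filter fun i =>
        rectFun M t₁ D (-1) i 1 = min 0 (-1) ∧ rectFun M t₁ D (-1) (i + 1) 1 = min 0 (-1)) =
        Finset.Icc (t₁ + 1) (t₁ + M) := by
      ext i
      simp only [Finset.mem_filter, Finset.mem_range, Finset.mem_Icc,
        min_eq_right (show (-1 : ℤ) ≤ 0 by norm_num)]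
      rcases rectFun_coords (M := M) (t₁ := t₁) (D := D) (v := -1) i with
          ⟨a1, -, ay⟩ | ⟨a1, a2, -, ay⟩ | ⟨a1, -, ay⟩ <;>
        rcases rectFun_coords (M := M) (t₁ := t₁) (D := D) (v := -1) (i + 1) with
          ⟨b1, -, bY⟩ | ⟨b1, b2, -, bY⟩ | ⟨b1, -, bY⟩ <;> omega
    rw [this, Nat.card_Icc]
    omega

end Rectangle

/-! ### Counting the rooted unit-height rectangles: `p^{242}_1(m, w) = [w = m ≥ 1]` -/

section Count

open Literature.Probability.RandomPlanarGeometry.SAW.Zd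

variable {M : ℕ}

/-- Two rooted polygons with the same vertex functions are equal. [folklore] -/
theorem sigma_walk_eq {e e' : Site 2} {p : (zdGraph 2).Walk (0 : Site 2) e}
    {p' : (zdGraph 2).Walk (0 : Site 2) e'} (hlen : p.length = p'.length)
    (h : ∀ k ≤ p.length, p.getVert k = p'.getVert k) :
    (⟨e, p⟩ : Σ e : Site 2, (zdGraph 2).Walk (0 : Site 2) e) = ⟨e', p'⟩ := by
  have he : e = e' := by
    rw [← p.getVert_length, ← p'.getVert_length, ← hlen]
    exact h _ le_rfl
  subst he
  rw [SimpleGraph.Walk.ext_getVert_le_length hlen h]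

/-- Conversely, equal rooted polygons have the same vertex functions. [folklore] -/
theorem getVert_eq_of_sigma_eq {e e' : Site 2} {p : (zdGraph 2).Walk (0 : Site 2) e}
    {p' : (zdGraph 2).Walk (0 : Site 2) e'}
    (h : (⟨e, p⟩ : Σ e : Site 2, (zdGraph 2).Walk (0 : Site 2) e) = ⟨e', p'⟩) (k : ℕ) :
    p.getVert k = p'.getVert k := by
  obtain ⟨rfl, hp⟩ := Sigma.mk.inj_iff.mp h
  rw [eq_of_heq hp]

/-- The rooted rectangle walk as a walk of `ℤ²` from `0`. [cite: Rechnitzer2006Haruspicy2, Lemma 25] -/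
def rectWalk (M t₁ : ℕ) (D v : ℤ) (hD : D = 1 ∨ D = -1) (hv : v = 1 ∨ v = -1) :
    (zdGraph 2).Walk (0 : Site 2) (rectFun M t₁ D v (2 * M + 1)) :=
  (walkOfFn (rectFun M t₁ D v) (2 * M + 1) fun i _ => rectFun_adj hD hv i).copy rectFun_zero rfl

variable {t₁ : ℕ} {D v : ℤ} (hD : D = 1 ∨ D = -1) (hv : v = 1 ∨ v = -1) (ht : t₁ ≤ M)

/-- `rectWalk` has `2M+1` steps. [folklore] -/
theorem length_rectWalk : (rectWalk M t₁ D v hD hv).length = 2 * M + 1 := by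
  simp [rectWalk]

/-- The vertices of `rectWalk`. [folklore] -/
theorem getVert_rectWalk (k : ℕ) :
    (rectWalk M t₁ D v hD hv).getVert k = rectFun M t₁ D v (min k (2 * M + 1)) := by
  simp [rectWalk, getVert_walkOfFn]

/-- The closed-up vertex function of `rectWalk` is `rectFun`. [folklore] -/
theorem closedVerts_rectWalk (ht : t₁ ≤ M) {k : ℕ} (hk : k ≤ 2 * M + 2) :
    closedVerts (rectWalk M t₁ D v hD hv) k = rectFun M t₁ D v k := by
  rcases hk.lt_or_eq with hk | rfl
  · rw [closedVerts_of_le _ (by rw [length_rectWalk]; omega), getVert_rectWalk,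
      min_eq_left (by omega)]
  · rw [show 2 * M + 2 = (rectWalk M t₁ D v hD hv).length + 1 by rw [length_rectWalk],
      closedVerts_length_succ, length_rectWalk, rectFun_N ht]

/-- `rectWalk` is self-avoiding. [folklore] -/
theorem isPath_rectWalk : (rectWalk M t₁ D v hD hv).IsPath := by
  rw [← SimpleGraph.Walk.IsPath.getVert_injOn_iff]
  intro i hi j hj hij
  simp only [Set.mem_setOf_eq, length_rectWalk] at hi hj
  rw [getVert_rectWalk, getVert_rectWalk, min_eq_left hi, min_eq_left hj] at hij
  exact rectFun_injOn hD hv (by simp only [Set.mem_setOf_eq]; omega)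
    (by simp only [Set.mem_setOf_eq]; omega) hij

/-- The horizontal bonds of a rooted polygon, closing bond included, counted on `polygonBonds`.
[cite: MadrasSlade1993, Definition 3.2.1] -/
theorem horizontalSteps_add_eq_countP {e : Site 2} (p : (zdGraph 2).Walk (0 : Site 2) e) :
    horizontalSteps p + (if e 1 = 0 then 1 else 0) =
      (polygonBonds p).countP fun b => b.1 1 = b.2 1 := by
  rw [polygonBonds, List.countP_cons, List.countP_map, horizontalSteps]
  simp only [Pi.zero_apply, Function.comp_def]
  by_cases he : e 1 = 0 <;> simp [he]

/-- `Is242 1`: one cell row, with two vertical bonds. [cite: Rechnitzer2006Haruspicy2, Definition 18] -/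
theorem is242_one_iff (L : List (Site 2 × Site 2)) :
    Is242 1 L ↔ yMax L - yMin L = 1 ∧ rowVerticalBonds L (yMin L) = 2 := by
  simp [Is242]

/-- Statistics of a rooted polygon whose closed-up vertex function is a rectangle walk: `2M`
horizontal bonds, one cell row, two vertical bonds in it, bottom row of width `M`.
[cite: Rechnitzer2006Haruspicy2, Lemma 25] -/
theorem stats_of_closedVerts_eq_rectFun (hD : D = 1 ∨ D = -1) (hv : v = 1 ∨ v = -1) (ht : t₁ ≤ M)
    (hM : 1 ≤ M) {e : Site 2} (p : (zdGraph 2).Walk (0 : Site 2) e)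
    (hlen : p.length = 2 * M + 1) (hc : ∀ k ≤ 2 * M + 2, closedVerts p k = rectFun M t₁ D v k) :
    horizontalSteps p + (if e 1 = 0 then 1 else 0) = 2 * M ∧ Is242 1 (polygonBonds p) ∧
      bottomWidth (polygonBonds p) = M := by
  have hcount : ∀ (P : Site 2 × Site 2 → Prop) [DecidablePred P],
      (polygonBonds p).countP (fun b => P b) =
        ((Finset.range (2 * M + 2)).filter fun i =>
          P (rectFun M t₁ D v i, rectFun M t₁ D v (i + 1))).card := by
    intro P _
    rw [countP_polygonBonds, hlen]
    congr 1
    refine Finset.filter_congr fun i hi => ?_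
    rw [Finset.mem_range] at hi
    simp only [decide_eq_true_eq]
    rw [hc i (by omega), hc (i + 1) (by omega)]
  -- `yMin = min 0 v`, `yMax = max 0 v`
  obtain ⟨hmin1, i₀, hi₀, hmin2⟩ := yMin_polygonBonds p
  obtain ⟨hmax1, i₁, hi₁, hmax2⟩ := yMax_polygonBonds p
  rw [hlen] at hmin1 hi₀ hmax1 hi₁
  have hyMin : yMin (polygonBonds p) = min 0 v := by
    have h0 := hmin1 0 (Nat.zero_le _)
    have h1 := hmin1 (t₁ + 1) (by omega)
    simp only [closedVerts_zero, Pi.zero_apply] at h0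
    rw [hc _ (by omega)] at h1 hmin2
    rcases rectFun_coords (M := M) (t₁ := t₁) (D := D) (v := v) (t₁ + 1) with
        ⟨a1, -, ay⟩ | ⟨-, -, -, ay⟩ | ⟨a1, -, ay⟩
    · omega
    · rw [ay] at h1
      rcases rectFun_coords (M := M) (t₁ := t₁) (D := D) (v := v) i₀ with
          ⟨-, -, by0⟩ | ⟨-, -, -, by0⟩ | ⟨-, -, by0⟩ <;> rw [by0] at hmin2 <;>
        simp only [min_def] at * <;> split_ifs <;> omega
    · omega
  have hyMax : yMax (polygonBonds p) = max 0 v := by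
    have h0 := hmax1 0 (Nat.zero_le _)
    have h1 := hmax1 (t₁ + 1) (by omega)
    simp only [closedVerts_zero, Pi.zero_apply] at h0
    rw [hc _ (by omega)] at h1 hmax2
    rcases rectFun_coords (M := M) (t₁ := t₁) (D := D) (v := v) (t₁ + 1) with
        ⟨a1, -, ay⟩ | ⟨-, -, -, ay⟩ | ⟨a1, -, ay⟩
    · omega
    · rw [ay] at h1
      rcases rectFun_coords (M := M) (t₁ := t₁) (D := D) (v := v) i₁ with
          ⟨-, -, by0⟩ | ⟨-, -, -, by0⟩ | ⟨-, -, by0⟩ <;> rw [by0] at hmax2 <;>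
        simp only [max_def] at * <;> split_ifs <;> omega
    · omega
  refine ⟨?_, ?_, ?_⟩
  · rw [horizontalSteps_add_eq_countP, hcount, card_filter_rectFun_hor hv ht]
  · rw [is242_one_iff, hyMax, hyMin, rowVerticalBonds, hcount]
    refine ⟨?_, ?_⟩
    · rcases hv with rfl | rfl <;> simp
    · rw [filter_rectFun_rowVertical (M := M) (t₁ := t₁) hD hv ht, Finset.card_pair (by omega)]
  · rw [bottomWidth, hyMin, hcount, card_filter_rectFun_bottom hv ht]

end Count

section Count2

open Literature.Probability.RandomPlanarGeometry.SAW.Zd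

variable {M : ℕ}

/-- The rooted polygons counted by `rooted242Count 1 M w` have rectangle walks as closed-up
vertex functions. [cite: Rechnitzer2006Haruspicy2, Lemma 25] -/
theorem exists_rectFun_of_rooted (hM : 1 ≤ M) {e : Site 2} (he : (zdGraph 2).Adj 0 e)
    {p : (zdGraph 2).Walk (0 : Site 2) e} (hlen : p.length = 2 * M + 1) (hpath : p.IsPath)
    (hhor : horizontalSteps p + (if e 1 = 0 then 1 else 0) = 2 * M) :
    ∃ t₁ ≤ M, ∃ D v : ℤ, (D = 1 ∨ D = -1) ∧ (v = 1 ∨ v = -1) ∧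
      ∀ k ≤ 2 * M + 2, closedVerts p k = rectFun M t₁ D v k := by
  classical
  apply IsClosedLoop.classify hM
  · refine ⟨closedVerts_zero p, ?_, fun i hi => ?_, fun i hi j hj hij => ?_⟩
    · rw [show 2 * M + 2 = p.length + 1 by omega]
      exact closedVerts_length_succ p
    · rcases Nat.lt_or_ge i p.length with hil | hil
      · rw [closedVerts_of_le p hil.le, closedVerts_of_le p hil]
        exact p.adj_getVert_succ hil
      · obtain rfl : i = p.length := by omega
        rw [closedVerts_length, closedVerts_length_succ]
        exact he.symm
    · simp only [Set.mem_setOf_eq] at hi hj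
      rw [closedVerts_of_le p (by omega), closedVerts_of_le p (by omega)] at hij
      exact hpath.getVert_injOn (by simp only [Set.mem_setOf_eq]; omega)
        (by simp only [Set.mem_setOf_eq]; omega) hij
  · rw [horizontalSteps_add_eq_countP, countP_polygonBonds, hlen] at hhor
    convert hhor using 2
    ext i
    simp only [Finset.mem_filter, Finset.mem_range, decide_eq_true_eq]

/-- In the middle of the rectangle walk. [folklore] -/
theorem rectFun_of_mid {t₁ : ℕ} {D v : ℤ} {i : ℕ} (h1 : t₁ < i) (h2 : i ≤ t₁ + M + 1) :
    rectFun M t₁ D v i = ![D * (2 * t₁ + 1 - i : ℤ), v] := by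
  unfold rectFun; rw [if_neg (by omega), if_pos h2]

/-- The ordinate of the rectangle walk is non-zero exactly on the far side. [folklore] -/
theorem rectFun_snd_ne_zero_iff {t₁ : ℕ} {D v : ℤ} (hv : v = 1 ∨ v = -1) (i : ℕ) :
    rectFun M t₁ D v i 1 ≠ 0 ↔ t₁ < i ∧ i ≤ t₁ + M + 1 := by
  rcases rectFun_coords (M := M) (t₁ := t₁) (D := D) (v := v) i with
    ⟨a1, -, ay⟩ | ⟨a1, a2, -, ay⟩ | ⟨a1, -, ay⟩ <;> rw [ay] <;> omega

/-- The parameters of a rectangle walk are determined by its first `2M+2` vertices. [folklore] -/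
theorem rectFun_params_eq (hM : 1 ≤ M) {t₁ t₁' : ℕ} {D D' v v' : ℤ} (ht : t₁ ≤ M) (ht' : t₁' ≤ M)
    (hD : D = 1 ∨ D = -1) (hD' : D' = 1 ∨ D' = -1) (hv : v = 1 ∨ v = -1) (hv' : v' = 1 ∨ v' = -1)
    (h : ∀ k ≤ 2 * M + 1, rectFun M t₁ D v k = rectFun M t₁' D' v' k) :
    t₁ = t₁' ∧ D = D' ∧ v = v' := by
  have htt : t₁ = t₁' := by
    have h1 := (rectFun_snd_ne_zero_iff (M := M) (t₁ := t₁) (D := D) hv (t₁ + 1)).mpr ⟨by omega, by omega⟩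
    have h2 := (rectFun_snd_ne_zero_iff (M := M) (t₁ := t₁') (D := D') hv' (t₁' + 1)).mpr ⟨by omega, by omega⟩
    rw [h (t₁ + 1) (by omega)] at h1
    rw [← h (t₁' + 1) (by omega)] at h2
    have h1' := (rectFun_snd_ne_zero_iff (M := M) hv' _).mp h1
    have h2' := (rectFun_snd_ne_zero_iff (M := M) hv _).mp h2
    omega
  subst htt
  have e1 := h (t₁ + 1) (by omega)
  have e2 := h (t₁ + 2) (by omega)
  rw [rectFun_of_mid (by omega) (by omega), rectFun_of_mid (by omega) (by omega), site_eq_iff] at e1 e2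
  simp only [vec2_zero, vec2_one] at e1 e2
  refine ⟨rfl, ?_, e1.2⟩
  rcases hD with rfl | rfl <;> rcases hD' with rfl | rfl <;> push_cast at e1 e2 <;> omega

/-- The sign encoded by a Boolean. [folklore] -/
def bsgn (b : Bool) : ℤ := if b then 1 else -1

/-- `bsgn` is a sign. [folklore] -/
theorem bsgn_cases (b : Bool) : bsgn b = 1 ∨ bsgn b = -1 := by cases b <;> simp [bsgn]

/-- `bsgn` decodes `decide (D = 1)`. [folklore] -/
theorem bsgn_decide {D : ℤ} (hD : D = 1 ∨ D = -1) : bsgn (decide (D = 1)) = D := by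
  rcases hD with rfl | rfl <;> rfl

/-- The parametrisation of the rooted unit-height rectangles of length `M` by
`(t₁, D, v) ∈ {0,…,M} × {±1} × {±1}`. [cite: Rechnitzer2006Haruspicy2, Lemma 25] -/
def rectParam (M : ℕ) (x : ℕ × Bool × Bool) : Σ e : Site 2, (zdGraph 2).Walk (0 : Site 2) e :=
  ⟨_, rectWalk M x.1 (bsgn x.2.1) (bsgn x.2.2) (bsgn_cases _) (bsgn_cases _)⟩

/-- **Counting the rooted unit-height rectangles**: for `M ≥ 1`,
`rooted242Count 1 M w = 4(M+1)` if `w = M` and `0` otherwise — each of the `M + 1` positions of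
the root on the axis-side row, the side `v = ±1` of the rectangle and the orientation `D = ±1`
gives one rooted polygon, and these are all (`IsClosedLoop.classify`).
[cite: Rechnitzer2006Haruspicy2, Lemma 25] [cite: MadrasSlade1993, eq. (3.2.1)] -/
theorem rooted242Count_one (hM : 1 ≤ M) (w : ℕ) :
    rooted242Count 1 M w = if w = M then 4 * (M + 1) else 0 := by
  classical
  rw [rooted242Count, if_neg (by omega), show 2 * (M + (3 * 1 - 2)) - 1 = 2 * M + 1 by omega]
  set F : (e : Site 2) → Finset ((zdGraph 2).Walk (0 : Site 2) e) := fun e =>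
    ((zdGraph 2).finsetWalkLength (2 * M + 1) (0 : Site 2) e).filter fun p =>
      p.IsPath ∧ horizontalSteps p + (if e 1 = 0 then 1 else 0) = 2 * M ∧
        Is242 1 (polygonBonds p) ∧ bottomWidth (polygonBonds p) = w with hF
  change ∑ e ∈ (zdGraph 2).neighborFinset 0, (F e).card = _
  rw [← Finset.card_sigma]
  set T := ((zdGraph 2).neighborFinset 0).sigma F with hT
  -- membership in `T`
  have memT : ∀ x : (Σ e : Site 2, (zdGraph 2).Walk (0 : Site 2) e), x ∈ T ↔
      (zdGraph 2).Adj 0 x.1 ∧ x.2.length = 2 * M + 1 ∧ x.2.IsPath ∧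
        horizontalSteps x.2 + (if x.1 1 = 0 then 1 else 0) = 2 * M ∧
          Is242 1 (polygonBonds x.2) ∧ bottomWidth (polygonBonds x.2) = w := by
    rintro ⟨e, p⟩
    simp only [hT, hF, Finset.mem_sigma, SimpleGraph.mem_neighborFinset, Finset.mem_filter,
      SimpleGraph.mem_finsetWalkLength_iff]
  -- every element of `T` is a rectangle walk, with `w = M`
  have classT : ∀ x ∈ T, ∃ t₁ ≤ M, ∃ D v : ℤ, (D = 1 ∨ D = -1) ∧ (v = 1 ∨ v = -1) ∧
      (∀ k ≤ 2 * M + 2, closedVerts x.2 k = rectFun M t₁ D v k) ∧ w = M := by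
    intro x hx
    obtain ⟨he, hlen, hpath, hhor, -, hbot⟩ := (memT x).mp hx
    obtain ⟨t₁, ht, D, v, hD, hv, hc⟩ := exists_rectFun_of_rooted hM he hlen hpath hhor
    refine ⟨t₁, ht, D, v, hD, hv, hc, ?_⟩
    rw [← hbot]
    exact (stats_of_closedVerts_eq_rectFun hD hv ht hM x.2 hlen hc).2.2
  split_ifs with hw
  · subst hw
    set P : Finset (ℕ × Bool × Bool) := Finset.range (w + 1) ×ˢ (Finset.univ ×ˢ Finset.univ) with hP
    have hTP : T = P.image (rectParam w) := by
      apply Finset.Subset.antisymm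
      · intro x hx
        obtain ⟨t₁, ht, D, v, hD, hv, hc, -⟩ := classT x hx
        obtain ⟨he, hlen, -⟩ := (memT x).mp hx
        rw [Finset.mem_image]
        refine ⟨(t₁, decide (D = 1), decide (v = 1)), ?_, ?_⟩
        · simp only [hP, Finset.mem_product, Finset.mem_range, Finset.mem_univ, and_true]; omega
        · obtain ⟨e, p⟩ := x
          simp only at hc hlen ⊢
          refine sigma_walk_eq (by rw [length_rectWalk]; exact hlen.symm) fun k hk => ?_
          rw [length_rectWalk] at hk
          rw [getVert_rectWalk, min_eq_left hk, bsgn_decide hD, bsgn_decide hv, ← hc k (by omega),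
            closedVerts_of_le p (by omega)]
      · intro x hx
        rw [Finset.mem_image] at hx
        obtain ⟨⟨t₁, bD, bv⟩, hy, rfl⟩ := hx
        simp only [hP, Finset.mem_product, Finset.mem_range, Finset.mem_univ, and_true] at hy
        rw [memT]
        simp only [rectParam]
        have hstats := stats_of_closedVerts_eq_rectFun (bsgn_cases bD) (bsgn_cases bv) (by omega) hM
          (rectWalk w t₁ (bsgn bD) (bsgn bv) (bsgn_cases _) (bsgn_cases _)) (length_rectWalk _ _)
          (fun k hk => closedVerts_rectWalk _ _ (by omega) hk)
        refine ⟨?_, length_rectWalk _ _, isPath_rectWalk _ _, hstats⟩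
        have := rectFun_adj (M := w) (t₁ := t₁) (bsgn_cases bD) (bsgn_cases bv) (2 * w + 1)
        rw [rectFun_N (by omega)] at this
        exact this.symm
    have hinj : Set.InjOn (rectParam w) P := by
      rintro ⟨t₁, bD, bv⟩ hx ⟨t₁', bD', bv'⟩ hy hxy
      simp only [hP, Finset.coe_product, Set.mem_prod, Finset.coe_range, Set.mem_Iio,
        Finset.coe_univ, Set.mem_univ, and_true] at hx hy
      have hk : ∀ k ≤ 2 * w + 1, rectFun w t₁ (bsgn bD) (bsgn bv) k = rectFun w t₁' (bsgn bD') (bsgn bv') k := by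
        intro k hk
        have := getVert_eq_of_sigma_eq hxy k
        rwa [getVert_rectWalk, getVert_rectWalk, min_eq_left hk] at this
      obtain ⟨h1, h2, h3⟩ := rectFun_params_eq hM (by omega) (by omega) (bsgn_cases _) (bsgn_cases _)
        (bsgn_cases _) (bsgn_cases _) hk
      have hb : ∀ b b' : Bool, bsgn b = bsgn b' → b = b' := by
        intro b b' h
        cases b <;> cases b' <;> simp [bsgn] at h ⊢
      rw [h1, hb _ _ h2, hb _ _ h3]
    rw [hTP, Finset.card_image_of_injOn hinj, hP, Finset.card_product, Finset.card_product,
      Finset.card_range, Finset.card_univ, Fintype.card_bool]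
    ring
  · rw [Finset.card_eq_zero, Finset.eq_empty_iff_forall_notMem]
    intro x hx
    obtain ⟨t₁, -, D, v, -, -, -, hwM⟩ := classT x hx
    exact hw hwM

/-- Hence `p^{242}_1(M, w) = [w = M ≥ 1]`: the only 2-4-2 polygon with two vertical bonds and
horizontal half-perimeter `M ≥ 1` is the `1 × M` rectangle, of bottom width `M`.
[cite: Rechnitzer2006Haruspicy2, Lemma 25] -/
theorem p242Count_one (M w : ℕ) : p242Count 1 M w = if w = M ∧ 1 ≤ M then 1 else 0 := by
  rcases Nat.eq_zero_or_pos M with rfl | hM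
  · rw [p242Count, rooted242Count, if_pos (by omega), Nat.zero_div, if_neg (by omega)]
  · rw [p242Count, rooted242Count_one hM, show 3 * 1 - 2 = 1 from rfl]
    split_ifs with h1 h2 h2
    · subst h1
      exact Nat.div_eq_of_eq_mul_left (by omega) (by ring)
    · exact absurd ⟨h1, hM⟩ h2
    · exact absurd h2.1 h1
    · simp

end Count2

/-! ### Discharge of `Rechnitzer2006_lem25_one`: `f_1(s;x) = sx/(1-sx)` -/

section Discharge

/-- The coefficients of `f_1`: `[x^M] f_1(s;x) = s^M` for `M ≥ 1`, `0` for `M = 0`.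
[cite: Rechnitzer2006Haruspicy2, Lemma 25] -/
theorem coeff_sap242BGF_one (M : ℕ) :
    PowerSeries.coeff M (sap242BGF 1) = if 1 ≤ M then Polynomial.X ^ M else 0 := by
  classical
  rw [sap242BGF, PowerSeries.coeff_mk]
  simp_rw [p242Count_one]
  split_ifs with hM
  · rw [Finset.sum_eq_single M]
    · simp [hM]
    · intro w _ hw
      rw [if_neg (by omega)]; simp
    · intro h; exact absurd (Finset.self_mem_range_succ M) h
  · exact Finset.sum_eq_zero fun w _ => by rw [if_neg (by omega)]; simp

/-- **Discharge of `Rechnitzer2006_lem25_one`** (Rechnitzer 2006, Lemma 25, first line of the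
recurrence: `f_1(s;x) = sx/(1-sx)`): in `ℚ[s]⟦x⟧`, `(1 - sx) f_1 = sx` — the 2-4-2 polygons with
two vertical bonds are the unit-height rectangles, `p^{242}_1(m,w) = [w = m ≥ 1]`
(`p242Count_one`, by the classification `IsClosedLoop.classify` of the closed self-avoiding
loops with two vertical steps and the count `rooted242Count_one` of their `2N = 4(m+1)` rooted
versions). [cite: Rechnitzer2006Haruspicy2, Lemma 25] -/
theorem Rechnitzer2006_lem25_one_holds : Rechnitzer2006_lem25_one := by
  classical
  unfold Rechnitzer2006_lem25_one
  refine PowerSeries.ext fun M => ?_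
  simp only [sP, Polynomial.coe_sub, Polynomial.coe_one, Polynomial.coe_mul, Polynomial.coe_C,
    Polynomial.coe_X, sub_mul, one_mul, map_sub]
  rw [mul_assoc, PowerSeries.coeff_C_mul, mul_comm (PowerSeries.X : PowerSeries ℚ[X]),
    PowerSeries.coeff_C_mul]
  rcases Nat.eq_zero_or_pos M with rfl | hM
  · simp [coeff_sap242BGF_one]
  · obtain ⟨M, rfl⟩ : ∃ M', M = M' + 1 := ⟨M - 1, by omega⟩
    rw [PowerSeries.coeff_succ_mul_X, coeff_sap242BGF_one, coeff_sap242BGF_one, PowerSeries.coeff_X]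
    rcases Nat.eq_zero_or_pos M with rfl | hM'
    · simp
    · rw [if_pos (by omega), if_pos (by omega), if_neg (by omega)]
      simp [pow_succ, mul_comm]

end Discharge

/-! ### Consequences: the remaining leaves -/

section Consequences

/-- **Discharge of the companion's `Rechnitzer2006_lem25_f1`** (the specialisations
`(1 - x^{j+1}) f_1(xʲ;x) = x^{j+1}` of `f_1 = sx/(1-sx)`). [cite: Rechnitzer2006Haruspicy2, Lemma 25] -/
theorem Rechnitzer2006_lem25_f1_holds : Rechnitzer2006_lem25_f1 :=
  Rechnitzer2006_lem25_f1_of_one Rechnitzer2006_lem25_one_holds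

/-- The companion's `Rechnitzer2006_eq38` from the recurrence of Lemma 25 alone.
[cite: Rechnitzer2006Haruspicy2, proof of Theorem 16] -/
theorem Rechnitzer2006_eq38_of_lem25_rec (hrec : Rechnitzer2006_lem25_rec) : Rechnitzer2006_eq38 :=
  Rechnitzer2006_eq38_of_lem25 Rechnitzer2006_lem25_one_holds hrec

/-- **Theorem 16 from its three remaining leaves**: Corollary 13, Lemma 20 (haruspicy with
sections: Theorems 6 and 12, Lemma 19) and the recurrence of Lemma 25 (Lemmas 21–24).
[cite: Rechnitzer2006Haruspicy2, Theorem 16] -/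
theorem Rechnitzer2006_thm16_of_cor13_lem20_lem25_rec (h13 : Rechnitzer2006_cor13)
    (h20 : Rechnitzer2006_lem20) (hrec : Rechnitzer2006_lem25_rec) : Rechnitzer2006_thm16 :=
  Rechnitzer2006_thm16_of_cor13_lem20_lem25 h13 h20 Rechnitzer2006_lem25_one_holds hrec

/-- **The barrier from its two remaining leaves**: with Theorem 1 proved
(`Rechnitzer2006_thm1_holds`), Theorem 15 proved, `f_1` proved and eq. (38) derived,
`SAPAnisotropicNotDFinite` (Corollary 27) rests on Lemma 20 and the recurrence of Lemma 25.
[cite: Rechnitzer2006Haruspicy2, Corollary 27] -/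
theorem sapAnisotropicNotDFinite_of_lem20_lem25_rec (h20 : Rechnitzer2006_lem20)
    (hrec : Rechnitzer2006_lem25_rec) : SAPAnisotropicNotDFinite :=
  sapAnisotropicNotDFinite_of_thm1_242 Rechnitzer2006_thm1_holds Rechnitzer2006_lem25_f1_holds
    (Rechnitzer2006_eq38_of_lem25_rec hrec) h20

end Consequences

end Literature.Barriers.CriticalPhenomena
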